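import Summits.QuantumFields.BalabanUV.Beta.EriceFlowEnclosureCesaroHigherOrder

/-!
# Beta / EriceFlowEnclosureCesaroTwoThirdsLaw — IN ROW L120's CLASS THE SQUARE ROOT IMPROVES TO TWO THIRDS: if `Φ′ = φ` on ]0, δ[ and φ is not
# merely log-Lipschitz (row L112 ∕ P2 #51a: Cesàro rate `A·s^γ` ⟹ `|φ − m| = O(t^{γ∕2})`, SHARP by P2 #51b∕#52b) but DIFFERENTIABLE WITH THE WINDOW
# MODULUS `|φ′(u) − φ′(t)| ≤ L(u − t)∕t²` (0 < t ≤ u < δ), then a Cesàro rate `|Φ s∕s − m| ≤ A·s^γ` (0 < γ ≤ 1) gives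
#     **`|φ t − m| ≤ (3A + 4L)·t^{2γ∕3}`**  on an explicit chart
# — the SYMMETRIC WINDOW `[t − η, t + η]`, `η = t·t^{γ∕3}`: the linear term integrates to zero, the Taylor defect costs `8Lη³∕t²`, the two
# primitive values cost `(9∕2)A·t^{1+γ}`, and `t^{1+γ}∕η = η²∕t² = t^{2γ∕3}` (the Landau–Kolmogorov interpolation between `∫φ` and `φ″`).
# THE POINT FOR THE LINEAGE: the three-loop Cesàro mean `M = (1∕t)∫₀ᵗ r∕u²` of a β in ROW L120's CLASS (r∕u² bounded AND K-log-Lipschitz) HAS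
# this window modulus (`M′ = (φ − M)∕t`, §2), so in that class the (C,2) → (C,1) passage of P2 #52a loses only `γ ↦ 2γ∕3`, not `γ ↦ γ∕2`
# (§3), and (C,2) → φ loses `γ ↦ γ∕3`, not `γ∕4`; P2 #52b's witness φ_W (exponent exactly ½) and gen 39's dressed witness β_W (P2 #56d) live
# OUTSIDE the class (φ_W′ ≍ u^{−3∕2}) — so rows L131–L142's square root is the law of the (T) + (SV) class, and row L120's class is
# strictly better.  Pure [folklore]; Mathlib + P2 #52a∕#51a only.
#   §1 `window_linear_integral` (`∫_{t−η}^{t+η} (x − t) dx = 0`), `window_defect_le` (`|∫_{t−η}^{t+η} φ − 2η·φ t| ≤ 8Lη³∕t²`),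
#      HEADLINE **`twoThirds_law`**;
#   §2 `quotient_hasDerivAt` (`(Φ∕id)′ = (φ − Φ∕id)∕t`), **`cesaro_deriv_windowModulus`** (bounded + log-Lipschitz φ and M ⟹ the window modulus
#      for M′ with `L = K + K_M + C + C_M`);
#   §3 END **`cesaro_twoThirds_of_cesaro2_power_rate`** ((C,2) rate `A s^γ` ⟹ (C,1) rate `(3A + 4(K + 4C))·t^{2γ∕3}` for bounded K-log-Lipschitz φ),
#      **`power_rate_third_of_cesaro2_power_rate`** (⟹ `|φ t − m| = O(t^{γ∕3})`, against P2 #52a's `t^{γ∕4}`).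
# (β-flow team, prover 2 = lower ∕ positivity side, unit `b2b-balaban-beta-bflow-p2`, gen 39; module P2 #56f; no Erice sentence occurs)

HONEST FRAMING (page 1 of everything the β sub-cell writes): discharging `BetaPertH` makes Bałaban's UV stability UNCONDITIONAL — a
real constructive-QFT result; it is NOT the continuum limit and NOT the Clay problem.  HONEST DEPENDENCY (cell reorg 2026-08-19,
verbatim): «continuum YM on T⁴ ⇐ BetaPertH ∧ nine spine estimates (0/9 proved); BetaPertH ⇐ (D1) ∧ (D4) ∧ CAP+tail; G-an2-4 gates
asym, D1 and NE2/3/4.»  THIS MODULE DISCHARGES NOTHING and quotes nothing: a [folklore] Tauberian remainder estimate (shapes: φ = the three-loop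
Cesàro mean M, Φ∕s its own Cesàro mean, row L120's log-Lipschitz clause on r∕u²).

WHAT THIS FILE PROVES (0 sorry, 0 def): §1 `window_linear_integral`, `window_defect_le`, HEADLINE **`twoThirds_law`**; §2 `quotient_hasDerivAt`,
**`cesaro_deriv_windowModulus`**; §3 END **`cesaro_twoThirds_of_cesaro2_power_rate`**, **`power_rate_third_of_cesaro2_power_rate`**.
NOT CLAIMED: SHARPNESS of 2∕3 inside the class (the natural witness `A(s) = (s² sin s^{−1∕3})′ = 2s sin s^{−1∕3} − (1∕3)s^{2∕3}cos s^{−1∕3}` —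
Cesàro rate s, window modulus ≍ 1∕s², not o(s^{2∕3}) — is not filed); the discrete ∕ bare-side transfer (row L131's sequence version); anything
about β beyond the shapes; `BetaPertH`; continuum; Clay.
-/

namespace Summit.QuantumFields.BalabanUV.Beta.EriceFlowEnclosureCesaroTwoThirdsLaw

open Set Filter Topology MeasureTheory intervalIntegral
open Summit.QuantumFields.BalabanUV.Beta.EriceFlowEnclosureCesaroTauberianRate (power_rate)
open Summit.QuantumFields.BalabanUV.Beta.EriceFlowEnclosureCesaroHigherOrder
  (const_nonneg cesaro_abs_le cesaro_logLip cesaro_primitive_hasDerivAt)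

noncomputable section

variable {Φ φ φ₁ : ℝ → ℝ} {δ τ L A γ m K C : ℝ}

/-! ## §1 The symmetric window and the two-thirds law -/

/-- `∫_{t−η}^{t+η} (x − t) dx = 0`. [folklore] -/
theorem window_linear_integral (t η : ℝ) : ∫ x in (t - η)..(t + η), (x - t) = 0 := by
  have hderiv : ∀ x ∈ uIcc (t - η) (t + η), HasDerivAt (fun y : ℝ => (y - t) ^ 2 / 2) (x - t) x := by
    intro x _
    have h := ((hasDerivAt_id x).sub_const t).pow 2 |>.div_const 2
    refine h.congr_deriv ?_
    simp only [id]
    ring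
  rw [intervalIntegral.integral_eq_sub_of_hasDerivAt hderiv ((continuous_id.sub continuous_const).intervalIntegrable _ _)]
  ring

/-- **THE WINDOW DEFECT**: φ with `φ′ = φ₁` on ]0, δ[ and the window modulus `|φ₁ u − φ₁ t| ≤ L(u − t)∕t²` (0 < t ≤ u < δ; L ≥ 0); then for
`0 < η ≤ t∕2` with `t + η < δ`: **`|∫_{t−η}^{t+η} φ − 2η·φ t| ≤ 8L·η³∕t²`** (`g(x) = φ x − φ t − (x − t)φ₁ t` has `|g′| ≤ 4Lη∕t²` on the window, so
`|g| ≤ 4Lη²∕t²`, and the linear term integrates to zero). [folklore] -/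
theorem window_defect_le (hφ : ∀ t ∈ Ioo 0 δ, HasDerivAt φ (φ₁ t) t) (hL : 0 ≤ L)
    (hmod : ∀ t u : ℝ, 0 < t → t ≤ u → u < δ → |φ₁ u - φ₁ t| ≤ L * (u - t) / t ^ 2)
    {t η : ℝ} (ht : 0 < t) (hη : 0 < η) (hηt : η ≤ t / 2) (htδ : t + η < δ) :
    |(∫ x in (t - η)..(t + η), φ x) - 2 * η * φ t| ≤ 8 * L * η ^ 3 / t ^ 2 := by
  have hlo : 0 < t - η := by linarith
  have hwin : ∀ x ∈ Icc (t - η) (t + η), x ∈ Ioo 0 δ := fun x hx => ⟨hlo.trans_le hx.1, lt_of_le_of_lt hx.2 htδ⟩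
  -- the derivative bound on the window
  have hder : ∀ x ∈ Icc (t - η) (t + η),
      HasDerivWithinAt (fun y => φ y - φ t - (y - t) * φ₁ t) (φ₁ x - φ₁ t) (Icc (t - η) (t + η)) x := by
    intro x hx
    have h1 := hφ x (hwin x hx)
    have h2 : HasDerivAt (fun y : ℝ => (y - t) * φ₁ t) (1 * φ₁ t) x := ((hasDerivAt_id x).sub_const t).mul_const _
    have h := (h1.sub_const (φ t)).sub h2
    rw [one_mul] at h
    exact h.hasDerivWithinAt
  have hbound : ∀ x ∈ Icc (t - η) (t + η), ‖φ₁ x - φ₁ t‖ ≤ 4 * L * η / t ^ 2 := by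
    intro x hx
    rw [Real.norm_eq_abs]
    rcases le_total t x with htx | hxt
    · have h := hmod t x ht htx (lt_of_le_of_lt hx.2 htδ)
      refine h.trans (div_le_div_of_nonneg_right ?_ (pow_pos ht 2).le)
      nlinarith [hx.2]
    · have hx0 : 0 < x := hlo.trans_le hx.1
      have h := hmod x t hx0 hxt (by linarith)
      rw [abs_sub_comm] at h
      refine h.trans ?_
      -- L(t − x)/x² ≤ Lη/x² ≤ Lη/(t/2)² = 4Lη/t²
      have hx2 : (t / 2) ^ 2 ≤ x ^ 2 := pow_le_pow_left₀ (by linarith) (by linarith [hx.1]) 2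
      have htx' : t - x ≤ η := by linarith [hx.1]
      calc L * (t - x) / x ^ 2 ≤ L * η / x ^ 2 := div_le_div_of_nonneg_right (mul_le_mul_of_nonneg_left htx' hL) (sq_nonneg x)
        _ ≤ L * η / (t / 2) ^ 2 := div_le_div_of_nonneg_left (by positivity) (pow_pos (by linarith) 2) hx2
        _ = 4 * L * η / t ^ 2 := by field_simp; ring
  -- |g x| ≤ (4Lη/t²)·|x − t| ≤ 4Lη²/t²
  have ht_mem : t ∈ Icc (t - η) (t + η) := ⟨by linarith, by linarith⟩
  have hg : ∀ x ∈ Icc (t - η) (t + η), |φ x - φ t - (x - t) * φ₁ t| ≤ 4 * L * η ^ 2 / t ^ 2 := by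
    intro x hx
    have h := Convex.norm_image_sub_le_of_norm_hasDerivWithin_le hder hbound (convex_Icc _ _) ht_mem hx
    simp only [sub_self, zero_mul, sub_zero, Real.norm_eq_abs] at h
    have hxt : |x - t| ≤ η := abs_le.mpr ⟨by linarith [hx.1], by linarith [hx.2]⟩
    calc |φ x - φ t - (x - t) * φ₁ t| ≤ 4 * L * η / t ^ 2 * |x - t| := h
      _ ≤ 4 * L * η / t ^ 2 * η := mul_le_mul_of_nonneg_left hxt (by positivity)
      _ = 4 * L * η ^ 2 / t ^ 2 := by ring
  -- integrate g over the window
  have hφc : ContinuousOn φ (Icc (t - η) (t + η)) := fun x hx => (hφ x (hwin x hx)).continuousAt.continuousWithinAt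
  have hab : t - η ≤ t + η := by linarith
  have hIφ : IntervalIntegrable φ volume (t - η) (t + η) := hφc.intervalIntegrable_of_Icc hab
  have hIlin : IntervalIntegrable (fun x => (x - t) * φ₁ t) volume (t - η) (t + η) :=
    ((continuousOn_id.sub continuousOn_const).mul continuousOn_const).intervalIntegrable_of_Icc hab
  have hsplit : ∫ x in (t - η)..(t + η), (φ x - φ t - (x - t) * φ₁ t)
      = (∫ x in (t - η)..(t + η), φ x) - 2 * η * φ t := by
    rw [intervalIntegral.integral_sub (hIφ.sub intervalIntegrable_const) hIlin,
      intervalIntegral.integral_sub hIφ intervalIntegrable_const, intervalIntegral.integral_const,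
      intervalIntegral.integral_mul_const, window_linear_integral]
    simp only [smul_eq_mul]
    ring
  rw [← hsplit]
  have hb : ∀ x ∈ Set.uIoc (t - η) (t + η), ‖φ x - φ t - (x - t) * φ₁ t‖ ≤ 4 * L * η ^ 2 / t ^ 2 := by
    intro x hx
    rw [uIoc_of_le hab] at hx
    rw [Real.norm_eq_abs]
    exact hg x ⟨hx.1.le, hx.2⟩
  have h := intervalIntegral.norm_integral_le_of_norm_le_const hb
  rw [Real.norm_eq_abs, show t + η - (t - η) = 2 * η by ring, abs_of_pos (show (0:ℝ) < 2 * η by linarith)] at h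
  calc |∫ x in (t - η)..(t + η), (φ x - φ t - (x - t) * φ₁ t)| ≤ 4 * L * η ^ 2 / t ^ 2 * (2 * η) := h
    _ = 8 * L * η ^ 3 / t ^ 2 := by ring

/-- **HEADLINE — THE TWO-THIRDS LAW.**  `Φ′ = φ` and `φ′ = φ₁` on ]0, δ[, the window modulus `|φ₁ u − φ₁ t| ≤ L(u − t)∕t²` (0 < t ≤ u < δ,
L ≥ 0), and the Cesàro rate `|Φ s∕s − m| ≤ A·s^γ` on ]0, τ] (A ≥ 0, 0 < γ ≤ 1).  Then for every t with
`0 < t ≤ min ((1∕2)^{3∕γ}) (min (τ∕2) (δ∕2))`: **`|φ t − m| ≤ (3A + 4L)·t^{2γ∕3}`** — against `t^{γ∕2}` for a merely log-Lipschitz φ (row L112,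
P2 #51a `power_rate`).  Window `η = t·t^{γ∕3} ≤ t∕2`; `2η(φ t − m) = [Φ(t+η) − Φ(t−η) − 2ηm] − [window defect]`, the first within
`(9∕2)A·t^{1+γ}`, the second within `8Lη³∕t²`. [folklore] (the elementary Landau–Kolmogorov case of the (C,1) remainder theorem) -/
theorem twoThirds_law (hΦ : ∀ t ∈ Ioo 0 δ, HasDerivAt Φ (φ t) t) (hφ : ∀ t ∈ Ioo 0 δ, HasDerivAt φ (φ₁ t) t) (hL : 0 ≤ L)
    (hmod : ∀ t u : ℝ, 0 < t → t ≤ u → u < δ → |φ₁ u - φ₁ t| ≤ L * (u - t) / t ^ 2)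
    (hA : 0 ≤ A) (hγ : 0 < γ) (hγ1 : γ ≤ 1) (hE : ∀ s ∈ Ioc 0 τ, |Φ s / s - m| ≤ A * s ^ γ) :
    ∀ t ∈ Ioc 0 (min ((1 / 2 : ℝ) ^ (3 / γ)) (min (τ / 2) (δ / 2))), |φ t - m| ≤ (3 * A + 4 * L) * t ^ (2 * γ / 3) := by
  intro t ht
  have ht0 : 0 < t := ht.1
  have htb : t ≤ (1 / 2 : ℝ) ^ (3 / γ) := ht.2.trans (min_le_left _ _)
  have htτ : t ≤ τ / 2 := ht.2.trans ((min_le_right _ _).trans (min_le_left _ _))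
  have htδ : t ≤ δ / 2 := ht.2.trans ((min_le_right _ _).trans (min_le_right _ _))
  -- the window half-width η = t · t^(γ/3) with t^(γ/3) ≤ 1/2
  set θ : ℝ := t ^ (γ / 3) with hθ
  have hθ0 : 0 < θ := Real.rpow_pos_of_pos ht0 _
  have hθ2 : θ ≤ 1 / 2 := by
    have h1 : t ^ (γ / 3) ≤ ((1 / 2 : ℝ) ^ (3 / γ)) ^ (γ / 3) := Real.rpow_le_rpow ht0.le htb (by positivity)
    rw [← Real.rpow_mul (by norm_num : (0:ℝ) ≤ 1 / 2), show 3 / γ * (γ / 3) = 1 by field_simp, Real.rpow_one] at h1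
    exact h1
  set η : ℝ := t * θ with hη
  have hη0 : 0 < η := mul_pos ht0 hθ0
  have hηt : η ≤ t / 2 := by rw [hη]; nlinarith
  have htηδ : t + η < δ := by linarith
  have htη : t - η ∈ Ioc 0 τ := ⟨by linarith, by linarith⟩
  have htη' : t + η ∈ Ioc 0 τ := ⟨by linarith, by linarith⟩
  -- (a) the window defect
  have hdef := window_defect_le hφ hL hmod ht0 hη0 hηt htηδ
  -- (b) the primitive values: Φ(t±η) = (t±η)(m + e±), |e±| ≤ A(t±η)^γ ≤ A(3t/2)^γ ≤ (3/2)A t^γ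
  have hpow : ∀ s : ℝ, 0 < s → s ≤ 3 / 2 * t → s ^ γ ≤ 3 / 2 * t ^ γ := by
    intro s hs hs'
    calc s ^ γ ≤ (3 / 2 * t) ^ γ := Real.rpow_le_rpow hs.le hs' hγ.le
      _ = (3 / 2) ^ γ * t ^ γ := Real.mul_rpow (by norm_num) ht0.le
      _ ≤ (3 / 2) ^ (1:ℝ) * t ^ γ := by
          refine mul_le_mul_of_nonneg_right ?_ (Real.rpow_nonneg ht0.le _)
          exact Real.rpow_le_rpow_of_exponent_le (by norm_num) hγ1
      _ = 3 / 2 * t ^ γ := by rw [Real.rpow_one]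
  have hprim : ∀ s : ℝ, s ∈ Ioc 0 τ → s ≤ 3 / 2 * t → |Φ s - s * m| ≤ s * (3 / 2 * A * t ^ γ) := by
    intro s hs hs'
    have h := hE s hs
    have hs0 : s ≠ 0 := hs.1.ne'
    have e : Φ s - s * m = s * (Φ s / s - m) := by
      field_simp
    rw [e, abs_mul, abs_of_pos hs.1]
    refine mul_le_mul_of_nonneg_left (h.trans ?_) hs.1.le
    calc A * s ^ γ ≤ A * (3 / 2 * t ^ γ) := mul_le_mul_of_nonneg_left (hpow s hs.1 hs') hA
      _ = 3 / 2 * A * t ^ γ := by ring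
  have hP1 := hprim (t + η) htη' (by linarith)
  have hP2 := hprim (t - η) htη (by linarith)
  -- (c) FTC on the window
  have hwin : ∀ x ∈ uIcc (t - η) (t + η), HasDerivAt Φ (φ x) x := by
    intro x hx
    rw [uIcc_of_le (by linarith : t - η ≤ t + η)] at hx
    exact hΦ x ⟨by linarith [hx.1], lt_of_le_of_lt hx.2 htηδ⟩
  have hφc : ContinuousOn φ (Icc (t - η) (t + η)) := fun x hx =>
    (hφ x ⟨by linarith [hx.1], lt_of_le_of_lt hx.2 htηδ⟩).continuousAt.continuousWithinAt
  have hftc : ∫ x in (t - η)..(t + η), φ x = Φ (t + η) - Φ (t - η) :=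
    intervalIntegral.integral_eq_sub_of_hasDerivAt hwin (hφc.intervalIntegrable_of_Icc (by linarith))
  -- (d) assemble: 2η(φ t − m) = (Φ(t+η) − (t+η)m) − (Φ(t−η) − (t−η)m) − [∫φ − 2ηφ t]
  have hkey : 2 * η * (φ t - m) = (Φ (t + η) - (t + η) * m) - (Φ (t - η) - (t - η) * m)
      - ((∫ x in (t - η)..(t + η), φ x) - 2 * η * φ t) := by rw [hftc]; ring
  have h2η : 0 < 2 * η := by linarith
  have habs : 2 * η * |φ t - m| ≤ (t + η) * (3 / 2 * A * t ^ γ) + (t - η) * (3 / 2 * A * t ^ γ) + 8 * L * η ^ 3 / t ^ 2 := by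
    have e : 2 * η * |φ t - m| = |2 * η * (φ t - m)| := by rw [abs_mul, abs_of_pos h2η]
    rw [e, hkey]
    refine (abs_sub _ _).trans (add_le_add ((abs_sub _ _).trans (add_le_add hP1 hP2)) hdef)
  have habs' : |φ t - m| ≤ 3 / 2 * A * t ^ γ * t / η + 4 * L * η ^ 2 / t ^ 2 := by
    have e : 3 / 2 * A * t ^ γ * t / η + 4 * L * η ^ 2 / t ^ 2
        = ((t + η) * (3 / 2 * A * t ^ γ) + (t - η) * (3 / 2 * A * t ^ γ) + 8 * L * η ^ 3 / t ^ 2) / (2 * η) := by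
      field_simp
      ring
    rw [e, le_div_iff₀ h2η]
    linarith [habs, mul_comm (2 * η) (|φ t - m|)]
  -- (e) the exponents: t^γ·t/η = t^γ/θ = t^(2γ/3)·… and η²/t² = θ² = t^(2γ/3)
  have hθ2eq : θ ^ 2 = t ^ (2 * γ / 3) := by
    rw [hθ, ← Real.rpow_natCast, ← Real.rpow_mul ht0.le]; congr 1; push_cast; ring
  have htne : t ≠ 0 := ht0.ne'
  have hθne : θ ≠ 0 := hθ0.ne'
  have hq1 : t ^ γ * t / η = t ^ (2 * γ / 3) := by
    have e1 : t ^ γ * t / η = t ^ γ / θ := by rw [hη]; field_simp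
    rw [e1, hθ, ← Real.rpow_sub ht0]
    congr 1; ring
  have hq2 : η ^ 2 / t ^ 2 = t ^ (2 * γ / 3) := by
    rw [← hθ2eq, hη, mul_pow]
    field_simp
  calc |φ t - m| ≤ 3 / 2 * A * t ^ γ * t / η + 4 * L * η ^ 2 / t ^ 2 := habs'
    _ = 3 / 2 * A * (t ^ γ * t / η) + 4 * L * (η ^ 2 / t ^ 2) := by ring
    _ = 3 / 2 * A * t ^ (2 * γ / 3) + 4 * L * t ^ (2 * γ / 3) := by rw [hq1, hq2]
    _ ≤ (3 * A + 4 * L) * t ^ (2 * γ / 3) := by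
        have : 0 ≤ t ^ (2 * γ / 3) := Real.rpow_nonneg ht0.le _
        nlinarith

/-! ## §2 The class: the Cesàro mean of a bounded log-Lipschitz function has the window modulus -/

/-- `(Φ∕id)′(t) = (φ t − Φ t∕t)∕t` for t ≠ 0 when `Φ′(t) = φ t`. [folklore] -/
theorem quotient_hasDerivAt {t : ℝ} (ht : t ≠ 0) (hΦ : HasDerivAt Φ (φ t) t) :
    HasDerivAt (fun s => Φ s / s) ((φ t - Φ t / t) / t) t := by
  have h := hΦ.div (hasDerivAt_id t) ht
  refine h.congr_deriv ?_
  simp only [id]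
  field_simp

/-- **THE CESÀRO MEAN OF A BOUNDED LOG-LIPSCHITZ FUNCTION HAS THE WINDOW MODULUS.**  `|φ| ≤ C`, φ K-log-Lipschitz (K ≥ 0) on ]0, δ[;
`M := Φ∕id` with `|M| ≤ C_M`, M K_M-log-Lipschitz (K_M ≥ 0; for `Φ = ∫₀φ`: C_M = C, K_M = 2C by P2 #52a).  Then the derivative
`(φ t − M t)∕t` of M (`quotient_hasDerivAt`) satisfies
**`|M′ u − M′ t| ≤ (K + K_M + C + C_M)·(u − t)∕t²`** for `0 < t ≤ u < δ` (`log(u∕t) ≤ (u − t)∕t`, `1∕t − 1∕u = (u − t)∕(tu)`). [folklore] -/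
theorem cesaro_deriv_windowModulus {KM CM : ℝ} (hK : 0 ≤ K) (hKM : 0 ≤ KM)
    (hb : ∀ t ∈ Ioo 0 δ, |φ t| ≤ C) (hbM : ∀ t ∈ Ioo 0 δ, |Φ t / t| ≤ CM)
    (hlip : ∀ t u : ℝ, 0 < t → t ≤ u → u < δ → |φ u - φ t| ≤ K * Real.log (u / t))
    (hlipM : ∀ t u : ℝ, 0 < t → t ≤ u → u < δ → |Φ u / u - Φ t / t| ≤ KM * Real.log (u / t)) :
    ∀ t u : ℝ, 0 < t → t ≤ u → u < δ →
      |(φ u - Φ u / u) / u - (φ t - Φ t / t) / t| ≤ (K + KM + C + CM) * (u - t) / t ^ 2 := by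
  intro t u ht htu hu
  have hu0 : 0 < u := ht.trans_le htu
  have htm : t ∈ Ioo 0 δ := ⟨ht, lt_of_le_of_lt htu hu⟩
  have hum : u ∈ Ioo 0 δ := ⟨hu0, hu⟩
  have hlog : Real.log (u / t) ≤ (u - t) / t := by
    have := Real.log_le_sub_one_of_pos (div_pos hu0 ht)
    rwa [div_sub_one ht.ne'] at this
  -- decomposition
  have e : (φ u - Φ u / u) / u - (φ t - Φ t / t) / t
      = ((φ u - φ t) - (Φ u / u - Φ t / t)) / u - (φ t - Φ t / t) * ((u - t) / (t * u)) := by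
    field_simp
    ring
  rw [e]
  have h1 : |((φ u - φ t) - (Φ u / u - Φ t / t)) / u| ≤ (K + KM) * ((u - t) / t) / u := by
    rw [abs_div, abs_of_pos hu0]
    refine div_le_div_of_nonneg_right ?_ hu0.le
    calc |(φ u - φ t) - (Φ u / u - Φ t / t)| ≤ |φ u - φ t| + |Φ u / u - Φ t / t| := abs_sub _ _
      _ ≤ K * Real.log (u / t) + KM * Real.log (u / t) := add_le_add (hlip t u ht htu hu) (hlipM t u ht htu hu)
      _ = (K + KM) * Real.log (u / t) := by ring
      _ ≤ (K + KM) * ((u - t) / t) := mul_le_mul_of_nonneg_left hlog (add_nonneg hK hKM)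
  have h2 : |(φ t - Φ t / t) * ((u - t) / (t * u))| ≤ (C + CM) * ((u - t) / (t * u)) := by
    rw [abs_mul, abs_of_nonneg (by positivity : (0:ℝ) ≤ (u - t) / (t * u))]
    refine mul_le_mul_of_nonneg_right ?_ (by positivity)
    exact (abs_sub _ _).trans (add_le_add (hb t htm) (hbM t htm))
  have hC0 : 0 ≤ C := (abs_nonneg _).trans (hb t htm)
  have hCM0 : 0 ≤ CM := (abs_nonneg _).trans (hbM t htm)
  calc |((φ u - φ t) - (Φ u / u - Φ t / t)) / u - (φ t - Φ t / t) * ((u - t) / (t * u))|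
      ≤ (K + KM) * ((u - t) / t) / u + (C + CM) * ((u - t) / (t * u)) := (abs_sub _ _).trans (add_le_add h1 h2)
    _ = (K + KM + C + CM) * (u - t) / (t * u) := by field_simp; ring
    _ ≤ (K + KM + C + CM) * (u - t) / t ^ 2 := by
        refine div_le_div_of_nonneg_left (by nlinarith) (pow_pos ht 2) ?_
        nlinarith

/-! ## §3 END — in row L120's class each averaging costs a third, not a half -/

/-- **END — THE TWO-THIRDS LAW FOR THE (C,1) DATUM OF A BOUNDED LOG-LIPSCHITZ φ.**  φ interval-integrable on ]0, δ] with `|φ| ≤ C`,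
K-log-Lipschitz (K ≥ 0), with the FTC `(∫₀φ)′ = φ` on ]0, δ[; M its Cesàro mean; (C,2) rate `|(1∕s)∫₀ˢ M − m| ≤ A·s^γ` on ]0, τ] (A ≥ 0,
0 < γ ≤ 1).  Then for `0 < t ≤ min ((1∕2)^{3∕γ}) (min (τ∕2) (δ∕2))`: **`|M t − m| ≤ (3A + 4(K + 4C))·t^{2γ∕3}`** — P2 #52a
`cesaro_power_rate_of_cesaro2_power_rate` gives `t^{γ∕2}` for a merely bounded φ and P2 #52b shows THAT is sharp; the log-Lipschitz clause of
row L120 buys the better exponent (§1 on φ := M, Φ := ∫₀M, with §2's window modulus, `C_M = C`, `K_M = 2C`). [folklore] -/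
theorem cesaro_twoThirds_of_cesaro2_power_rate (hδ : 0 < δ) (hint : ∀ t ∈ Ioc 0 δ, IntervalIntegrable φ volume 0 t)
    (hb : ∀ v ∈ Ioc 0 δ, |φ v| ≤ C) (hK : 0 ≤ K)
    (hFTC : ∀ t ∈ Ioo 0 δ, HasDerivAt (fun s => ∫ v in (0:ℝ)..s, φ v) (φ t) t)
    (hlip : ∀ t u : ℝ, 0 < t → t ≤ u → u < δ → |φ u - φ t| ≤ K * Real.log (u / t))
    (hA : 0 ≤ A) (hγ : 0 < γ) (hγ1 : γ ≤ 1)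
    (hE : ∀ s ∈ Ioc 0 τ, |(∫ v in (0:ℝ)..s, (∫ w in (0:ℝ)..v, φ w) / v) / s - m| ≤ A * s ^ γ) :
    ∀ t ∈ Ioc 0 (min ((1 / 2 : ℝ) ^ (3 / γ)) (min (τ / 2) (δ / 2))),
      |(∫ w in (0:ℝ)..t, φ w) / t - m| ≤ (3 * A + 4 * (K + 4 * C)) * t ^ (2 * γ / 3) := by
  have hC := const_nonneg hδ hb
  -- the window modulus of M′
  have hmod := cesaro_deriv_windowModulus (Φ := fun s => ∫ v in (0:ℝ)..s, φ v) (KM := 2 * C) (CM := C) hK (by positivity)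
    (fun t ht => hb t ⟨ht.1, ht.2.le⟩) (fun t ht => cesaro_abs_le hb ⟨ht.1, ht.2.le⟩) hlip (cesaro_logLip hint hb)
  have hL : (0:ℝ) ≤ K + 2 * C + C + C := by positivity
  have h := twoThirds_law (Φ := fun s => ∫ v in (0:ℝ)..s, (∫ w in (0:ℝ)..v, φ w) / v) (φ := fun s => (∫ w in (0:ℝ)..s, φ w) / s)
    (φ₁ := fun t => (φ t - (∫ w in (0:ℝ)..t, φ w) / t) / t) (L := K + 2 * C + C + C)
    (cesaro_primitive_hasDerivAt hδ hint hb) (fun t ht => quotient_hasDerivAt ht.1.ne' (hFTC t ht)) hL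
    (fun t u ht htu hu => hmod t u ht htu hu) hA hγ hγ1 hE
  intro t ht
  have := h t ht
  have e : (K + 2 * C + C + C) = K + 4 * C := by ring
  rwa [e] at this

/-- **… AND ONE LEVEL FURTHER DOWN: `|φ t − m| = O(t^{γ∕3})`** (P2 #51a `power_rate` on top of §3: `γ′ = 2γ∕3`, exponent `γ′∕2 = γ∕3`), against
P2 #52a `power_rate_of_cesaro2_power_rate`'s `t^{γ∕4}` — in row L120's class the two averagings between the three-loop remainder r∕u² and
its (C,2) datum cost `γ ↦ γ∕3`, not `γ ↦ γ∕4`. [folklore] -/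
theorem power_rate_third_of_cesaro2_power_rate (hδ : 0 < δ) (hint : ∀ t ∈ Ioc 0 δ, IntervalIntegrable φ volume 0 t)
    (hb : ∀ v ∈ Ioc 0 δ, |φ v| ≤ C) (hK : 0 ≤ K)
    (hFTC : ∀ t ∈ Ioo 0 δ, HasDerivAt (fun s => ∫ v in (0:ℝ)..s, φ v) (φ t) t)
    (hlip : ∀ t u : ℝ, 0 < t → t ≤ u → u < δ → |φ u - φ t| ≤ K * Real.log (u / t))
    (hA : 0 ≤ A) (hγ : 0 < γ) (hγ1 : γ ≤ 1)
    (hE : ∀ s ∈ Ioc 0 τ, |(∫ v in (0:ℝ)..s, (∫ w in (0:ℝ)..v, φ w) / v) / s - m| ≤ A * s ^ γ) :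
    ∀ t ∈ Ioc 0 (min 1 (min ((min ((1 / 2 : ℝ) ^ (3 / γ)) (min (τ / 2) (δ / 2))) / 2) (δ / 4))),
      |φ t - m| ≤ (K + 3 * 2 ^ (2 * γ / 3) * (3 * A + 4 * (K + 4 * C))) * t ^ (γ / 3) := by
  have hC := const_nonneg hδ hb
  have h1 := cesaro_twoThirds_of_cesaro2_power_rate hδ hint hb hK hFTC hlip hA hγ hγ1 hE
  have h2 := power_rate (τ := min ((1 / 2 : ℝ) ^ (3 / γ)) (min (τ / 2) (δ / 2))) (A := 3 * A + 4 * (K + 4 * C)) (γ := 2 * γ / 3)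
    (m := m) hFTC hK hlip (by positivity) (by positivity) h1
  intro t ht
  have h := h2 t ht
  rwa [show 2 * γ / 3 / 2 = γ / 3 by ring] at h

end

end Summit.QuantumFields.BalabanUV.Beta.EriceFlowEnclosureCesaroTwoThirdsLaw
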